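import Literature.RepresentationTheory.Kovacevic2021.SU21UnitarityCriterion
import Literature.RepresentationTheory.Kovacevic2021.SU21RayWeights
import HarnessLib

/-!
# Unitarity of the ray modules: `D₂ = U(0,6)`, `J_{1,0} = Z(3)`, `D₀ = U(0,-6)`, `J_{0,1} = Z(-3)`

Continuation of `Literature.RepresentationTheory.Kovacevic2021.SU21UnitarityCriterion` (a datum is unitarizable
as soon as positive weights solve the `𝔨`-recursion and the two edge recursions) and of `SU21RayWeights` (the
explicit solution `rayWeight e n₀ n k = α(n-n₀) β_n(k-1)` of these recursions on a ray with `A_n = -(2n+e+1)/2`,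
`D = 1`).  [Kovacevic2021, §4 Thm 4] proves that `U(l,2t)` and `Z(s)` carry invariant positive Hermitian forms;
[BorelWallach2000, VI Thm 4.12 (2)] (Kraljević) records that the cohomological `J_{ij}` are unitary, and the
`D_i` are discrete series.  Here: the north-east ray data `rayNE e n₀` (arrows `A`, `D`) and the south-east ray
data `raySE e n₀` (arrows `B`, `C`) of `SU21ModulesFromKTypes` are unitarizable whenever `2n₀ + e + 1 > 0`
(`rayNE_isUnitarizable`, `raySE_isUnitarizable`), hence so are the four cohomological ray modules
`holDS = U(0,6)`, `ladderPlus = Z(3)`, `antiholDS = U(0,-6)`, `ladderMinus = Z(-3)`.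
Theorems only; no named facts.

## References

* D. Kovačević, *Unitary `(𝔤,K)` modules of `SU(2,1)`*, Acta Math. Spalatensia 1 (2021) 105–125
  (arXiv:1810.01752): §4 Thm 4, Thm 5 (`U(l,2t)`, `Z(s)` unitary). [Kovacevic2021]
* A. Borel, N. Wallach (2000), VI Thm 4.12 (2) p. 133; VI 4.8 p. 131. [BorelWallach2000]
-/

noncomputable section

namespace Literature.RepresentationTheory.Kovacevic2021

-- Mathlib idiom (Mathlib/Algebra/Lie/OfAssociative.lean): commutator brackets on associative algebras; needed for
-- the `𝔤𝔩(3,ℂ)`-module structure on `𝒟.V`, as in every file of this directory.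
attribute [local instance 100] LieRing.ofAssociativeRing

namespace SU21Datum

/-! ## The north-east rays (`A`–`D` arrows) -/

/-- **The north-east ray data are unitarizable**: on `rayNE e n₀` (`K`-types `V_{n,3n+e}`, `n ≥ n₀`,
`A_n = -(2n+e+1)/2`, `D = 1`) with `2n₀ + e + 1 > 0` the weights `c(n,m,k) = α(n-n₀) β_n(k-1)` of
`SU21RayWeights` define an invariant positive definite Hermitian form.
[cite: Kovacevic2021, §4 Thm 4] [cite: BorelWallach2000, VI Thm 4.12 (2)] -/
theorem rayNE_isUnitarizable (e n₀ : ℤ) (h₀ : 1 ≤ n₀) (h : 2 * n₀ ^ 2 + (e - 3) * n₀ + (1 - e) = 0)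
    (he : 0 < 2 * n₀ + e + 1) : IsUnitarizable (rayNE e n₀ h₀ h) := by
  refine isUnitarizable_of_weights _ (fun n _ k => rayWeight e n₀ n k) ?_ ?_ ?_ ?_
  · intro n m k _ hk hkn
    exact rayWeight_pos e n₀ h₀ he hk hkn
  · intro n m k _ hk _
    rw [rayWeight_succ_k e n₀ hk]
    ring
  · rintro n m k ⟨hn, hm⟩ ⟨-, -⟩ hk hkn
    change n₀ ≤ n at hn
    change m = 3 * n + e at hm
    subst hm
    have hA : (rayNE e n₀ h₀ h).A n (3 * n + e) = -(2 * (n : ℂ) + e + 1) / 2 := by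
      dsimp only [rayNE]
      rw [if_pos ⟨hn, rfl⟩]
    have hD : (rayNE e n₀ h₀ h).D (n + 1) (3 * n + e + 3) = 1 := by
      dsimp only [rayNE]
      rw [if_pos ⟨by omega, by ring⟩]
    have key := rayWeight_succ_n e n₀ h₀ he hn hk hkn
    have key' : ((n : ℂ) + 1 - k) * ((2 * n + e + 1) / 2) * (rayWeight e n₀ (n + 1) k : ℂ)
        = rayWeight e n₀ n k := by exact_mod_cast key
    rw [hA, hD]
    simp only [map_div₀, map_neg, map_add, map_mul, map_one, map_ofNat, map_intCast]
    linear_combination (-1 : ℂ) * key'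
  · intro n m k _ _ _ _
    rw [show (rayNE e n₀ h₀ h).C n m = 0 from rfl, show (rayNE e n₀ h₀ h).B (n - 1) (m + 3) = 0 from rfl,
      map_zero, zero_mul, mul_zero, neg_zero, zero_mul]

/-! ## The south-east rays (`B`–`C` arrows) -/

/-- **The south-east ray data are unitarizable**: on `raySE e n₀` (`K`-types `V_{n,-(3n+e)}`, `n ≥ n₀`,
`B_n = -(2n+e+1)/2`, `C = 1`) with `2n₀ + e + 1 > 0` the same weights `c(n,m,k) = α(n-n₀) β_n(k-1)` define an
invariant positive definite Hermitian form. [cite: Kovacevic2021, §4 Thm 4] [cite: BorelWallach2000, VI Thm 4.12 (2)] -/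
theorem raySE_isUnitarizable (e n₀ : ℤ) (h₀ : 1 ≤ n₀) (h : 2 * n₀ ^ 2 + (e - 3) * n₀ + (1 - e) = 0)
    (he : 0 < 2 * n₀ + e + 1) : IsUnitarizable (raySE e n₀ h₀ h) := by
  refine isUnitarizable_of_weights _ (fun n _ k => rayWeight e n₀ n k) ?_ ?_ ?_ ?_
  · intro n m k _ hk hkn
    exact rayWeight_pos e n₀ h₀ he hk hkn
  · intro n m k _ hk _
    rw [rayWeight_succ_k e n₀ hk]
    ring
  · intro n m k _ _ _ _
    rw [show (raySE e n₀ h₀ h).A n m = 0 from rfl, show (raySE e n₀ h₀ h).D (n + 1) (m + 3) = 0 from rfl,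
      map_zero, mul_zero, zero_mul, neg_zero, zero_mul]
  · rintro n m k ⟨-, hm⟩ ⟨hn', -⟩ hk hkn
    change m = -(3 * n + e) at hm
    change n₀ ≤ n - 1 at hn'
    subst hm
    have hC : (raySE e n₀ h₀ h).C n (-(3 * n + e)) = 1 := by
      dsimp only [raySE]
      rw [if_pos ⟨by omega, rfl⟩]
    have hB : (raySE e n₀ h₀ h).B (n - 1) (-(3 * n + e) + 3) = -(2 * ((n - 1 : ℤ) : ℂ) + e + 1) / 2 := by
      dsimp only [raySE]
      rw [if_pos ⟨hn', by ring⟩]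
    have key := rayWeight_succ_n e n₀ h₀ he hn' hk hkn
    rw [sub_add_cancel] at key
    have key' : (((n - 1 : ℤ) : ℂ) + 1 - k) * ((2 * ((n - 1 : ℤ) : ℂ) + e + 1) / 2) * (rayWeight e n₀ n k : ℂ)
        = rayWeight e n₀ (n - 1) k := by exact_mod_cast key
    rw [hC, hB, map_one]
    push_cast at key' ⊢
    linear_combination (-1 : ℂ) * key'

/-! ## The four cohomological ray modules -/

/-- **`D₂ = U(0,6)` (the holomorphic discrete series, `H^{2,0}`) is unitarizable.**
[cite: Kovacevic2021, §4 Thm 4, Thm 5] [cite: BorelWallach2000, VI 4.8, Thm 4.12] -/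
theorem holDS_isUnitarizable : IsUnitarizable holDS :=
  rayNE_isUnitarizable 3 1 le_rfl (by norm_num) (by norm_num)

/-- **`J_{1,0} = Z(3)` (the ladder representation, `H^{1,0} ⊕ H^{2,1}`) is unitarizable** (Kraljević).
[cite: Kovacevic2021, §4 Thm 4, Thm 5] [cite: BorelWallach2000, VI Thm 4.12 (2)] -/
theorem ladderPlus_isUnitarizable : IsUnitarizable ladderPlus :=
  rayNE_isUnitarizable (-3) 2 (by norm_num) (by norm_num) (by norm_num)

/-- **`D₀ = U(0,-6)` (the antiholomorphic discrete series, `H^{0,2}`) is unitarizable.**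
[cite: Kovacevic2021, §4 Thm 4, Thm 5] [cite: BorelWallach2000, VI 4.8, Thm 4.12] -/
theorem antiholDS_isUnitarizable : IsUnitarizable antiholDS :=
  raySE_isUnitarizable 3 1 le_rfl (by norm_num) (by norm_num)

/-- **`J_{0,1} = Z(-3)` (the conjugate ladder representation, `H^{0,1} ⊕ H^{1,2}`) is unitarizable**
(Kraljević). [cite: Kovacevic2021, §4 Thm 4, Thm 5] [cite: BorelWallach2000, VI Thm 4.12 (2)] -/
theorem ladderMinus_isUnitarizable : IsUnitarizable ladderMinus :=
  raySE_isUnitarizable (-3) 2 (by norm_num) (by norm_num) (by norm_num)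

end SU21Datum

end Literature.RepresentationTheory.Kovacevic2021
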